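import Literature.NumberTheory.GaloisRepresentations.IdeleBarKSInflationTrunc
import Literature.NumberTheory.GaloisRepresentations.PresentationGaloisModulesS
import Literature.Algebra.Homology.DiscreteRepInflationQuotientExact
import HarnessLib

/-!
# The boundary of the `S`-presentation under inflation: `Inf(δ_S ∘ [f]) ≫ ι_S = [e₃] ∘ δ ∘ [e₁⁻¹ ≫ f♯]`
# (the `C_{G_S}`-side extension class of `f : N₁^S ⟶ I_S` read in `C_{Γ_K}`; Harari §4.3 Remark 4.24, Milne I §4 p. 58)

Topic `NumberTheory/GaloisRepresentations`; namespace `Literature.NumberTheory.GaloisRepresentations.IdeleClassBar`.  THEOREMS ONLY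
(no definition, no named fact, no instance, no `sorry`).  Sequel to `IdeleBarKSInflationTrunc.lean` (`sharp K S f = f♯`,
`sharp_eq_map_comp_sharp_id`: `f♯ = Inf f ≫ ι_S`), -w7 g11's `PresentationGaloisModulesS.lean` (`presentationComplexS ρ S`, the counit
isomorphisms `inflPresentationSIso₁₂₃` and their squares) and `Algebra/Homology/DiscreteRepInflationQuotientExact.lean` (`inflExtHom`,
inflation on `Ext` along `Γ_K ↠ G_S`, with `inflExtHom_mk₀/_comp/_extClass`).

THE MATHEMATICS.  `K` a number field, `S` finite, `ρ` a finite Galois module unramified outside `S` (`hur : N_S ≤ ker ρ`),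
`T = presentationComplex ρ : 0 → N₁ → P → M → 0` in `C_{Γ_K}` and `T_S = presentationComplexS ρ S : 0 → N₁^S → P^S → M^{N_S} → 0` in
`C_{G_S}`, `eᵢ : Inf (T_S.Xᵢ) ≅ T.Xᵢ`.  The inflated sequence `Inf T_S` is short exact and ISOMORPHIC to `T` through `(e₁, e₂, e₃)`
(`inflPresentationSIsoHom`), so by the naturality of extension classes
  `[Inf T_S] ∘ [e₁] = [e₃] ∘ [T]`   (`extClass_map_inflQuotFunctor_comp_mk₀`)
and, for a `G_S`-morphism `f : N₁^S ⟶ I_S` with `f♯ = Inf f ≫ ι_S` (`ι_S := (𝟙 I_S)♯ : Inf I_S ⟶ J̄`):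
  **`Inf(δ_S ∘ [f]) ∘ [ι_S] = [e₃] ∘ (δ ∘ [e₁⁻¹ ≫ f♯])`**   (`inflExtHom_extClass_comp_mk₀_comp_sharp_id`)
in `Ext¹_{C_{Γ_K}}(Inf M^{N_S}, J̄)` — the `G_S`-side boundary class of `f` (the argument of `invS` in (R4)_S) is, after inflation
and `I_S ⊆ J̄`, door-c6's boundary class of `presSharp f = e₁⁻¹ ≫ f♯` (the argument of `classBarInv` in the tree's all-places
reciprocity sum), up to the counit isomorphism `e₃`.  Step (a) of the (R4)_S plan (`F2D-SCOPING-w6g11.md`).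

Cell bsd-eis, lane «PT-Ш-S-TC», brick D4b (seat bsd-line-x1-p1-w6 gen 11).  HONEST FRAMING: bookkeeping; no duality statement and no
case of BSD is proved here.

## References
* D. Harari, *Galois Cohomology and Class Field Theory*, Universitext, Springer (2020), §4.3 Remark 4.24, Prop. 17.26 (proof). [Harari2020]
* J. S. Milne, *Arithmetic Duality Theorems*, 2nd ed. (2006), I §4, proof of Thm. 4.10 (p. 58), Lemma 4.13. [MilneADT2006]
* C. A. Weibel, *An introduction to homological algebra* (1994), §3.4 (naturality of extension classes), §10.7. [Weibel1994]
-/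

noncomputable section

open NumberField IsDedekindDomain CategoryTheory CategoryTheory.Abelian
open Field (absoluteGaloisGroup)
open Literature.NumberTheory.Automorphic Literature.Algebra.Homology Literature.Algebra.Homology.DiscreteRep
open scoped Classical

namespace Literature.NumberTheory.GaloisRepresentations

namespace IdeleClassBar

open FreePresentation

variable {K : Type} [Field K] [NumberField K]
variable {M : Type} [AddCommGroup M] [TopologicalSpace M] [DiscreteTopology M] [Finite M]
variable (ρ : DiscreteGaloisModule K M) (S : Finset (HeightOneSpectrum (𝓞 K)))
  (hur : ramificationSubgroup K (↑S : Set (HeightOneSpectrum (𝓞 K))) ≤ ContinuousRep.ker ρ)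

/-! ## §1. `Inf T_S ≅ T` as short complexes -/

/-- **The isomorphism of short complexes `Inf T_S ⟶ T`** with components the counit isomorphisms `e₁, e₂, e₃`.
[cite: Harari2020, §4.3 Remark 4.24] -/
def inflPresentationSIsoHom :
    (presentationComplexS ρ (↑S : Set (HeightOneSpectrum (𝓞 K)))).map
        (inflQuotFunctor ℤ (ramificationSubgroup K (↑S : Set (HeightOneSpectrum (𝓞 K))))) ⟶
      presentationComplex ρ where
  τ₁ := (inflPresentationSIso₁ ρ (↑S : Set (HeightOneSpectrum (𝓞 K))) hur).hom
  τ₂ := (inflPresentationSIso₂ ρ (↑S : Set (HeightOneSpectrum (𝓞 K))) hur).hom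
  τ₃ := (inflPresentationSIso₃ ρ (↑S : Set (HeightOneSpectrum (𝓞 K))) hur).hom
  comm₁₂ := (inflQuotFunctor_map_presentationComplexS_f ρ (↑S : Set (HeightOneSpectrum (𝓞 K))) hur).symm
  comm₂₃ := (inflQuotFunctor_map_presentationComplexS_g ρ (↑S : Set (HeightOneSpectrum (𝓞 K))) hur).symm

/-- Components (definitional). [cite: Harari2020, §4.3 Remark 4.24] -/
theorem inflPresentationSIsoHom_τ₁ : (inflPresentationSIsoHom ρ S hur).τ₁ =
    (inflPresentationSIso₁ ρ (↑S : Set (HeightOneSpectrum (𝓞 K))) hur).hom := rfl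

/-- Components (definitional). [cite: Harari2020, §4.3 Remark 4.24] -/
theorem inflPresentationSIsoHom_τ₃ : (inflPresentationSIsoHom ρ S hur).τ₃ =
    (inflPresentationSIso₃ ρ (↑S : Set (HeightOneSpectrum (𝓞 K))) hur).hom := rfl

/-- **Naturality of the extension class along `Inf T_S ≅ T`: `[Inf T_S] ∘ [e₁] = [e₃] ∘ [T]`.** [cite: Weibel1994, §3.4] -/
theorem extClass_map_inflQuotFunctor_comp_mk₀ :
    (shortExact_map_inflQuotFunctor (ramificationSubgroup K (↑S : Set (HeightOneSpectrum (𝓞 K))))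
          (presentationComplexS_shortExact ρ (↑S : Set (HeightOneSpectrum (𝓞 K))) hur)).extClass.comp
        (Ext.mk₀ (inflPresentationSIso₁ ρ (↑S : Set (HeightOneSpectrum (𝓞 K))) hur).hom) (add_zero 1) =
      (Ext.mk₀ (inflPresentationSIso₃ ρ (↑S : Set (HeightOneSpectrum (𝓞 K))) hur).hom).comp
        (presentationComplex_shortExact ρ).extClass (zero_add 1) :=
  ShortComplex.ShortExact.extClass_naturality _ _ (inflPresentationSIsoHom ρ S hur)

/-! ## §2. The inflated `S`-boundary of `f : N₁^S ⟶ I_S` -/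

/-- **`Inf(δ_S ∘ [f]) = [Inf T_S] ∘ [Inf f]`.** [cite: Weibel1994, §10.7] [cite: Harari2020, §4.3 Remark 4.24] -/
theorem inflExtHom_extClass_comp_mk₀ (f : (presentationComplexS ρ (↑S : Set (HeightOneSpectrum (𝓞 K)))).X₁ ⟶ truncIdeleBarD K S) :
    inflExtHom (ramificationSubgroup K (↑S : Set (HeightOneSpectrum (𝓞 K)))) _ _ 1
        ((presentationComplexS_shortExact ρ (↑S : Set (HeightOneSpectrum (𝓞 K))) hur).extClass.comp (Ext.mk₀ f) (add_zero 1)) =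
      (shortExact_map_inflQuotFunctor (ramificationSubgroup K (↑S : Set (HeightOneSpectrum (𝓞 K))))
          (presentationComplexS_shortExact ρ (↑S : Set (HeightOneSpectrum (𝓞 K))) hur)).extClass.comp
        (Ext.mk₀ ((inflKS K S).map f)) (add_zero 1) := by
  rw [inflExtHom_comp, inflExtHom_extClass, inflExtHom_mk₀]
  rfl

/-- **`Inf(δ_S ∘ [f]) ∘ [ι_S] = [e₃] ∘ (δ ∘ [e₁⁻¹ ≫ f♯])`** in `Ext¹_{C_{Γ_K}}(Inf M^{N_S}, J̄)`: the inflated `G_S`-boundary of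
`f`, pushed into `J̄`, is door-c6's boundary of `presSharp f = e₁⁻¹ ≫ f♯` up to `e₃`.
[cite: MilneADT2006, I Thm. 4.10 (proof, p. 58)] [cite: Harari2020, §4.3 Remark 4.24, Prop. 17.26 (proof)] [cite: Weibel1994, §3.4] -/
theorem inflExtHom_extClass_comp_mk₀_comp_sharp_id
    (f : (presentationComplexS ρ (↑S : Set (HeightOneSpectrum (𝓞 K)))).X₁ ⟶ truncIdeleBarD K S) :
    (inflExtHom (ramificationSubgroup K (↑S : Set (HeightOneSpectrum (𝓞 K)))) _ _ 1
        ((presentationComplexS_shortExact ρ (↑S : Set (HeightOneSpectrum (𝓞 K))) hur).extClass.comp (Ext.mk₀ f)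
          (add_zero 1))).comp (Ext.mk₀ (sharp K S (𝟙 (truncIdeleBarD K S)))) (add_zero 1) =
      (Ext.mk₀ (inflPresentationSIso₃ ρ (↑S : Set (HeightOneSpectrum (𝓞 K))) hur).hom).comp
        ((presentationComplex_shortExact ρ).extClass.comp
          (Ext.mk₀ ((inflPresentationSIso₁ ρ (↑S : Set (HeightOneSpectrum (𝓞 K))) hur).inv ≫ sharp K S f)) (add_zero 1))
        (zero_add 1) := by
  -- notation: `cS` the inflated `S`-class, `cT` door-c6's class, `e₁ e₃` the counits, `F = Inf f`, `ι = (𝟙 I_S)♯`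
  have s1 := inflExtHom_extClass_comp_mk₀ ρ S hur f
  have s4 : (inflKS K S).map f ≫ sharp K S (𝟙 (truncIdeleBarD K S)) =
      (inflPresentationSIso₁ ρ (↑S : Set (HeightOneSpectrum (𝓞 K))) hur).hom ≫
        ((inflPresentationSIso₁ ρ (↑S : Set (HeightOneSpectrum (𝓞 K))) hur).inv ≫ sharp K S f) := by
    rw [Iso.hom_inv_id_assoc, ← sharp_eq_map_comp_sharp_id]
  have s8 := extClass_map_inflQuotFunctor_comp_mk₀ ρ S hur
  rw [s1]
  calc _ = (shortExact_map_inflQuotFunctor (ramificationSubgroup K (↑S : Set (HeightOneSpectrum (𝓞 K))))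
            (presentationComplexS_shortExact ρ (↑S : Set (HeightOneSpectrum (𝓞 K))) hur)).extClass.comp
          ((Ext.mk₀ ((inflKS K S).map f)).comp (Ext.mk₀ (sharp K S (𝟙 (truncIdeleBarD K S)))) (zero_add 0)) (add_zero 1) :=
        Ext.comp_assoc_of_second_deg_zero _ _ _ _
    _ = (shortExact_map_inflQuotFunctor (ramificationSubgroup K (↑S : Set (HeightOneSpectrum (𝓞 K))))
            (presentationComplexS_shortExact ρ (↑S : Set (HeightOneSpectrum (𝓞 K))) hur)).extClass.comp
          ((Ext.mk₀ (inflPresentationSIso₁ ρ (↑S : Set (HeightOneSpectrum (𝓞 K))) hur).hom).comp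
            (Ext.mk₀ ((inflPresentationSIso₁ ρ (↑S : Set (HeightOneSpectrum (𝓞 K))) hur).inv ≫ sharp K S f)) (zero_add 0))
          (add_zero 1) := by
        rw [Ext.mk₀_comp_mk₀, Ext.mk₀_comp_mk₀, s4]
    _ = ((shortExact_map_inflQuotFunctor (ramificationSubgroup K (↑S : Set (HeightOneSpectrum (𝓞 K))))
            (presentationComplexS_shortExact ρ (↑S : Set (HeightOneSpectrum (𝓞 K))) hur)).extClass.comp
          (Ext.mk₀ (inflPresentationSIso₁ ρ (↑S : Set (HeightOneSpectrum (𝓞 K))) hur).hom) (add_zero 1)).comp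
          (Ext.mk₀ ((inflPresentationSIso₁ ρ (↑S : Set (HeightOneSpectrum (𝓞 K))) hur).inv ≫ sharp K S f)) (add_zero 1) :=
        (Ext.comp_assoc_of_second_deg_zero _ _ _ _).symm
    _ = ((Ext.mk₀ (inflPresentationSIso₃ ρ (↑S : Set (HeightOneSpectrum (𝓞 K))) hur).hom).comp
          (presentationComplex_shortExact ρ).extClass (zero_add 1)).comp
          (Ext.mk₀ ((inflPresentationSIso₁ ρ (↑S : Set (HeightOneSpectrum (𝓞 K))) hur).inv ≫ sharp K S f)) (add_zero 1) := by
        rw [s8]; rfl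
    _ = _ := Ext.comp_assoc_of_third_deg_zero _ _ _ _

end IdeleClassBar

end Literature.NumberTheory.GaloisRepresentations

end
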